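import Summits.ResolutionOfSingularities.ResolutionOfSingularities.Theses.RuledResidues
import Literature.AlgebraicGeometry.Resolution.DivisorialPlace

/-!
# `RegularModelRuled` (crux `stmt-ResolutionOfSingularities-18077`): the conjunct
# `IsDiscreteValuationRing W` is NOT load-bearing (it follows from the other hypotheses)

Hypothesis-minimality lemma for the crux `RegularModelRuled` of route
`ResolutionOfSingularities/RuledResidues`, filed by the standing disprover (cdisprove cycle 1,
`--supports stmt-ResolutionOfSingularities-18077`; work file `Cruxes/RegularModelRuled/Disproof.lean`,
companion of `Negative/FalseWithoutDimTwo.lean`). The crux quantifies over valuation rings `W ⊇ k`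
of `K` that are (i) discrete valuation rings and (ii) essentially of finite type over `k`
(`W = B_{𝔪_W ∩ B}`, `B` finitely generated), containing an affine model `A` whose local ring at the
centre `𝔮 = 𝔪_W ∩ A` is regular of dimension `≥ 2`.

* `isDiscreteValuationRing_of_model_of_two_le` — (i) is implied by (ii) together with
  `2 ≤ dim A_𝔮` (for ANY subalgebra `A ⊆ W`; neither `A.FG`, nor `Frac A = K`, nor regularity is
  used): `W = B_𝔭` is a localisation of a Noetherian ring
  (`Literature…DivisorialPlace.isLocalization_atPrime_of_model`), hence a Noetherian valuation ring,
  i.e. a DVR unless it is a field; and if `W` is a field then `𝔪_W = ⊥`, the centre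
  `comap 𝔪_W = ⊥` has height `0`, so `dim A_𝔮 = 0 < 2`.

So any prover may discard the DVR binder, and a planner restating the item may drop the conjunct.
No definition is declared; no declaration concludes a route decl.

References: Zariski–Samuel, *Commutative Algebra* II, Ch. VI §14, Corollary preceding Thm. 32
("since `R_𝔭` is noetherian, the valuation `v` is discrete, of rank 1").
-/

noncomputable section

set_option linter.dupNamespace false

open IsLocalRing
open Literature.AlgebraicGeometry.Resolution

namespace Summit.ResolutionOfSingularities.ResolutionOfSingularities.Theorems.RegularModelRuled.Negative

/-- **The DVR conjunct of `RegularModelRuled` is decoration.** For a valuation ring `W` of `K`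
that is essentially of finite type over `k` (the crux's divisorial clause, verbatim) and a
subalgebra `A ⊆ W` whose local ring at the centre of `W` has Krull dimension `≥ 2`, `W` is a
discrete valuation ring. [cite: ZariskiSamuel1960, Ch. VI §14, Corollary preceding Thm. 32] -/
theorem isDiscreteValuationRing_of_model_of_two_le (k K : Type) [Field k] [Field K] [Algebra k K]
    (W : ValuationSubring K)
    (hW : ∃ B : Subalgebra k K, B.FG ∧ B.toSubring ≤ W.toSubring ∧
      ∀ x : K, x ∈ W → ∃ b s : K, b ∈ B ∧ s ∈ B ∧ s ∉ W.nonunits ∧ x * s = b)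
    (A : Subalgebra k K) (h : A.toSubring ≤ W.toSubring)
    (hdim : (2 : WithBot ℕ∞) ≤ ringKrullDim (Localization.AtPrime
      (Ideal.comap (Subring.inclusion h) (IsLocalRing.maximalIdeal W)))) :
    IsDiscreteValuationRing W := by
  obtain ⟨B, hBfg, hBW, hloc⟩ := hW
  haveI : Algebra.FiniteType k B := B.fg_iff_finiteType.mp hBfg
  haveI : IsNoetherianRing B := Algebra.FiniteType.isNoetherianRing k B
  letI := (Subring.inclusion hBW : B →+* W).toAlgebra
  haveI := isLocalization_atPrime_of_model W hBW hloc
  haveI : IsNoetherianRing W :=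
    IsLocalization.isNoetherianRing (centreIdeal B W hBW).primeCompl _ inferInstance
  have hnf : ¬ IsField W := by
    intro hF
    have hbot : IsLocalRing.maximalIdeal W = ⊥ :=
      (IsLocalRing.isField_iff_maximalIdeal_eq).mp hF
    have hq : Ideal.comap (Subring.inclusion h) (IsLocalRing.maximalIdeal W) = ⊥ := by
      rw [hbot]
      exact Ideal.comap_bot_of_injective (Subring.inclusion h) (Subring.inclusion_injective h)
    have e := IsLocalization.AtPrime.ringKrullDim_eq_height
      (Ideal.comap (Subring.inclusion h) (IsLocalRing.maximalIdeal W))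
      (Localization.AtPrime (Ideal.comap (Subring.inclusion h) (IsLocalRing.maximalIdeal W)))
    rw [e, hq, Ideal.height_bot] at hdim
    exact absurd hdim (by decide)
  have hV : ValuationRing W := inferInstance
  exact ((IsDiscreteValuationRing.TFAE W hnf).out 0 1).mpr hV

/-- **Hence the crux with the DVR binder deleted is EQUIVALENT to the crux** (the deleted variant
trivially implies the crux; conversely feed `isDiscreteValuationRing_of_model_of_two_le`). Stated as
the implication from the variant WITHOUT the binder to the variant WITH it re-supplied as a mere
consequence: every instance of the crux's hypotheses already carries a DVR. [folklore] -/
theorem regularModelRuled_dvr_binder_derivable (k K : Type) [Field k] [Field K] [Algebra k K]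
    (W : ValuationSubring K)
    (hW : ∃ B : Subalgebra k K, B.FG ∧ B.toSubring ≤ W.toSubring ∧
      ∀ x : K, x ∈ W → ∃ b s : K, b ∈ B ∧ s ∈ B ∧ s ∉ W.nonunits ∧ x * s = b)
    (A : Subalgebra k K) (h : A.toSubring ≤ W.toSubring)
    (hdim : (2 : WithBot ℕ∞) ≤ ringKrullDim (Localization.AtPrime
      (Ideal.comap (Subring.inclusion h) (IsLocalRing.maximalIdeal W)))) :
    (∀ c : k, algebraMap k K c ∈ W) ∧ IsDiscreteValuationRing W := by
  obtain ⟨B, hBfg, hBW, hloc⟩ := hW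
  exact ⟨fun c => hBW (algebraMap k B c).2,
    isDiscreteValuationRing_of_model_of_two_le k K W ⟨B, hBfg, hBW, hloc⟩ A h hdim⟩

end Summit.ResolutionOfSingularities.ResolutionOfSingularities.Theorems.RegularModelRuled.Negative

end
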